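import Summits.BirchSwinnertonDyer.BirchSwinnertonDyer.Theses.KolyvaginRankRigidityAtTwo
import Summits.BirchSwinnertonDyer.BirchSwinnertonDyer.Theorems.KolyvaginRankRigidityAtTwoKolyvaginCorankLowerBoundAtTwoRichOfProp37

/-!
# Crux V2♭∞ `KolyvaginCorankLowerBoundAtTwoRich` (stmt-BirchSwinnertonDyer-27984, route `KolyvaginRankRigidityAtTwo`,
# crux r3) — line `kolyvagin_depth_split_rich`: TERMINAL SKELETON (LEAD krr2-p1 g14, 2026-08-28)

State of the line, kernel-exact: every mathematical stub of the g8 skeleton (`stub_primeSwapAtTwoLossy`,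
`stub_localTrivialAtConductor`, and the width stubs S2–S4, T1–T3, P4–P8) has LANDED as a Theorems file, and the
crux decl holds BY NAME from ONE named print fact:
`Theorems.KolyvaginLowerBoundAtTwo.KolyvaginCorankLowerBoundAtTwoRich_of_prop37
  (h37 : GrossLMS1991.prop37_2_frobeniusCongruence) : KolyvaginCorankLowerBoundAtTwoRich` (p641767, accepted;
re-pointed to the split children 28229 / 28230, both CLOSED·proved).

So the skeleton below has exactly ONE stub, and that stub is not a lemma of ours but the published input
Gross 1991 Prop. 3.7 (2) (= Nekovář 2007 Prop. 4.13 (ii)): the Frobenius congruence `y_n ≡ Frob(λ_m)·y_m (mod λ_n)`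
of the Heegner Euler system — ledger item stmt-BirchSwinnertonDyer-23091, an auto-held cite-only Literature input.
Discharging it is a Literature TYPING programme (modular curves as schemes over `ℤ[1/N]`: reduction of CM points,
"every `ℓ`-isogeny out of a supersingular point in characteristic `ℓ` is Frobenius", good reduction of the modular
parametrisation `φ`), not a Summits proof: no `E`-level derivation exists (the `E`-level data leave a full
`Ĥ⁻¹(G_ℓ, E(K[n]_{λ_n})) ≅ Ẽ(𝔽_{ℓ²})[ℓ+1]`-torsor undetermined — evidence LEAD-REPORT-g9.md and
PROP372-OBSTRUCTION-g11.md on item 23091).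

HONEST FRAMING: the crux is CLOSED MODULO that one print fact and NOT closed outright; the rung
`Rank1Residual.NonCMTwoConverse` additionally needs U1 `KolyvaginBoundedDefectAtTwo` (stmt-28083 = Kolyvagin's
Conjecture A at `p = 2`, open in print) and the printed inputs; the Birch–Swinnerton-Dyer conjecture is NOT proved
by any of this.
-/

set_option autoImplicit false
set_option linter.dupNamespace false

namespace Summit.BirchSwinnertonDyer.BirchSwinnertonDyer.Cruxes.KolyvaginCorankLowerBoundAtTwoRich.KolyvaginDepthSplitRich

open Summit.BirchSwinnertonDyer.BirchSwinnertonDyer.Theses.KolyvaginRankRigidityAtTwo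

/-- **STUB (the only one) = the published input Gross 1991 Prop. 3.7 (2)** (ledger item stmt-BirchSwinnertonDyer-23091,
cite-only Literature declaration `GrossLMS1991.prop37_2_frobeniusCongruence`): the Frobenius congruence of the
Heegner Euler system. Not a lemma of this line — it closes only when the Literature fact is typed and proved
(Eichler–Shimura in characteristic `ℓ` on an integral model of `X₀(N)`). [cite: GrossLMS1991, Prop. 3.7 (2) p. 240]
[cite: Nekovar2007, Prop. 4.13 (ii)] -/
theorem stub_prop37_2 : Literature.NumberTheory.EllipticCurves.GrossLMS1991.prop37_2_frobeniusCongruence := by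
  sorry

/-- **Composition**: the crux decl `KolyvaginCorankLowerBoundAtTwoRich` BY NAME from the single stub, through the
accepted kernel theorem `KolyvaginCorankLowerBoundAtTwoRich_of_prop37` (p641767: depth split + lossy prime swap at `2`
+ triangular systems + Poitou–Tate as a tree theorem). [cite: Kolyvagin1991MathAnn, §2 Thm. 2.2–2.3] -/
theorem KolyvaginCorankLowerBoundAtTwoRich_of : KolyvaginCorankLowerBoundAtTwoRich :=
  Summit.BirchSwinnertonDyer.BirchSwinnertonDyer.Theorems.KolyvaginLowerBoundAtTwo.KolyvaginCorankLowerBoundAtTwoRich_of_prop37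
    stub_prop37_2

end Summit.BirchSwinnertonDyer.BirchSwinnertonDyer.Cruxes.KolyvaginCorankLowerBoundAtTwoRich.KolyvaginDepthSplitRich
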